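import Mathlib
import HarnessLib
import Summits.Parity.GeneralizedHardyLittlewood.Theses.LeeYangFibres

/-!
# Sketch — crux-ideate stmt-Parity-14108 (FibreHyperbolicity), ideator 2, round 1

First lemmas of the two idea cards (they only need to ELABORATE; proofs are not claimed):

* card `sieve-accuracy-beats-margin`  : `RoughCellMargin`, `FlatFibreHyperbolicity`,
  first lemma `flatFibre_of_margin : RoughCellMargin → FlatFibreHyperbolicity`.
* card `restricted-cycle-stirling-avatar` : `RestrictedCycleStirlingRealRooted`,
  `RestrictedCycleScaling`, first lemma `modelHyperbolicity_of_stirling`.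
-/

namespace Summit.Parity.GeneralizedHardyLittlewood.Cruxes.FibreHyperbolicity.Ideator2

open scoped BigOperators Classical
open Literature.NumberTheory.Sieve

/-- The rough-integer Ω-cells `A_j(x) = #{m ≤ x : P⁻(m) > x^{1/u}, Ω(m) = j}` (as inlined in the
route file). -/
noncomputable def roughCell (u x j : ℕ) : ℕ :=
  ((Finset.Icc 1 x).filter (fun m => (x : ℝ) ^ ((1 : ℝ) / u) < (Nat.minFac m : ℝ) ∧
    ArithmeticFunction.cardFactors m = j)).card

/-- The joint rough Ω-cell `C_j(Ψ, K, N, u)` of a `d = 1` system (verbatim the route's inlined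
cell). -/
noncomputable def jointCell {t : ℕ} (Ψ : Fin t → AffLinForm 1) (K : Set (Fin 1 → ℝ)) (N u : ℕ)
    (j : Fin t → ℕ) : ℕ :=
  ((latticeBox 1 N).filter (fun n => realPoint n ∈ K ∧ ∀ k, (N : ℝ) ^ ((1 : ℝ) / u) <
    (Nat.minFac ((Ψ k).eval n).toNat : ℝ) ∧ ArithmeticFunction.cardFactors ((Ψ k).eval n).toNat = j k)).card

/-- **Model margin, exponential form** (card A's model-side stub; card B's target). There are
`c > 0` and `u₁` such that for every `u ≥ u₁` and all large `x`, every coefficient vector within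
RELATIVE distance `e^{-c u}` of the rough-cell vector `(A_j(x))_{1 ≤ j ≤ u}` (coordinatewise) is the
coefficient vector of a real-rooted polynomial. Numerically the parity-direction threshold is
`θ*(u) ≈ 10^{-0.4u} = e^{-0.92u}` (refuter, crux-attack on stmt-Parity-14108; kit j000121), so any
`c > 0.92·(1+o(1))` should do; the statement only asks for SOME `c`. -/
def RoughCellMargin : Prop :=
  ∃ c : ℝ, 0 < c ∧ ∃ u₁ : ℕ, ∀ u : ℕ, u₁ ≤ u → ∃ x₀ : ℕ, ∀ x : ℕ, x₀ ≤ x →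
    ∀ p : ℕ → ℝ, (∀ j ∈ Finset.Icc 1 u, |p j - roughCell u x j| ≤ Real.exp (-(c * u)) * roughCell u x j) →
      ∀ ζ : ℂ, (∑ j ∈ Finset.Icc 1 u, (p j : ℂ) * ζ ^ j) = 0 → ζ.im = 0

/-- **Flat-fibre hyperbolicity** — the `w = (1,…,1)` fibres of `FibreHyperbolicity`, for ALL large
`u` (not merely cofinally): the Ω-distribution of ONE form `ψ_i` over jointly `N^{1/u}`-rough tuples,
`T_a^{(i)} = #{n ∈ K : Ω(ψ_i(n)) = a, every ψ_k(n) rough}`, has a real-rooted generating polynomial.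
These coefficients are sieve-visible (BV for `E_a(y)`-numbers along `ψ_i` + the `(t-1)`-dimensional
fundamental lemma at `s = u/2`), to relative accuracy `exp(-(u/2) log(u/2)(1+o(1)))`, which beats any
exponential margin. -/
def FlatFibreHyperbolicity : Prop :=
  ∀ (t L : ℕ), 1 ≤ t → ∀ η : ℝ, 0 < η → ∃ u₁ : ℕ, ∀ u : ℕ, u₁ ≤ u → ∃ N₀ : ℕ, ∀ N : ℕ, N₀ ≤ N →
    ∀ Ψ : Fin t → AffLinForm 1, IsNondegenerateSystem Ψ → affLinSize Ψ N ≤ L →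
    ∀ K : Set (Fin 1 → ℝ), Convex ℝ K → K ⊆ realBox 1 N →
    η * (N : ℝ) ≤ archFactor Ψ K * singularProduct Ψ →
    ∀ i : Fin t, ∀ ζ : ℂ,
      (∑ j ∈ Fintype.piFinset (fun _ : Fin t => Finset.Icc 1 u),
        ((jointCell Ψ K N u j : ℕ) : ℂ) * ζ ^ (j i)) = 0 → ζ.im = 0

/-- FIRST LEMMA of card `sieve-accuracy-beats-margin`: an exponential model margin already gives
the flat fibres of the crux, unconditionally in the arithmetic (Bombieri–Vinogradov for almost-primes
along one form, Halberstam–Richert's fundamental lemma with `exp(-s log s + …)` decay in dimension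
`t - 1`, Alladi's parity-free cell asymptotics). Not proved here. -/
theorem flatFibre_of_margin : RoughCellMargin → FlatFibreHyperbolicity := by
  sorry

/-- Sanity link: the flat fibres are literally among the crux's fibres (`w = fun _ => 1`), so the
crux implies the COFINAL form of flat-fibre hyperbolicity. (Provable by `simp`-bookkeeping; left as
a sketch.) -/
theorem cofinalFlat_of_crux (h : Theses.LeeYangFibres.FibreHyperbolicity) :
    ∀ (t L u₀ : ℕ), 1 ≤ t → ∀ η : ℝ, 0 < η → ∃ u : ℕ, u₀ ≤ u ∧ 2 ≤ u ∧ ∃ N₀ : ℕ, ∀ N : ℕ, N₀ ≤ N →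
    ∀ Ψ : Fin t → AffLinForm 1, IsNondegenerateSystem Ψ → affLinSize Ψ N ≤ L →
    ∀ K : Set (Fin 1 → ℝ), Convex ℝ K → K ⊆ realBox 1 N →
    η * (N : ℝ) ≤ archFactor Ψ K * singularProduct Ψ →
    ∀ i : Fin t, ∀ ζ : ℂ,
      (∑ j ∈ Fintype.piFinset (fun _ : Fin t => Finset.Icc 1 u),
        ((jointCell Ψ K N u j : ℕ) : ℂ) * ∏ k, (if k = i then ζ else ((1 : ℝ) : ℂ)) ^ (j k)) = 0 → ζ.im = 0 := by
  intro t L u₀ ht η hη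
  obtain ⟨u, hu₀, hu2, N₀, hN⟩ := h t L u₀ ht η hη
  refine ⟨u, hu₀, hu2, N₀, fun N hN' Ψ hΨ hL K hK hKB hη' i ζ hz => ?_⟩
  exact hN N hN' Ψ hΨ hL K hK hKB hη' i (fun _ => 1) (fun _ => ⟨one_pos, le_rfl⟩) ζ hz

/-! ## Card B: the exact discrete avatar -/

/-- Restricted-cycle Stirling polynomial of the first kind: `E_{n,m}(z) = ∑_{σ ∈ S_n, all cycles
longer than m} z^{#cycles(σ)}` (`(m+1)`-associated Stirling numbers of the first kind as
coefficients). It obeys `E_{n+1} = n E_n + n(n-1)⋯(n-m+1) · z · E_{n-m}`. -/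
noncomputable def restrictedCycleStirling (n m : ℕ) (z : ℂ) : ℂ :=
  ∑ σ ∈ (Finset.univ : Finset (Equiv.Perm (Fin n))).filter (fun σ => ∀ l ∈ σ.cycleType, m < l),
    z ^ Multiset.card σ.cycleType

/-- FIRST LEMMA of card `restricted-cycle-stirling-avatar` (the cheapest falsifier is an exact
Sturm computation, kit j006646): for `m < n` the restricted-cycle Stirling polynomial has only real
zeros. (`m < n` excludes the empty sum: the `n`-cycle is always admissible.) -/
def RestrictedCycleStirlingRealRooted : Prop :=
  ∀ n m : ℕ, m < n → ∀ z : ℂ, restrictedCycleStirling n m z = 0 → z.im = 0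

/-- **Span-(m+1) window interlacing, Hermite–Kakeya–Obreschkoff form** (card B's first lemma; new):
for `m ≥ 1` and `m < a < b ≤ a + m + 1`, every real combination `α E_{a,m} + β E_{b,m}` (not both
zero) has only real zeros — equivalently the zeros of `E_{a,m}/x` and `E_{b,m}/x` weakly interlace.
Kit (this session, exact Sturm): 5272 combinations inside the window, 0 failures; the window is sharp
(at `b = a + m + 2` degrees differ by two). Real-rootedness of each `E_{n,m}` alone is Brenti's
theorem (Mező 2020, ch. 10, Outlook 4). -/
def RestrictedCycleWindowHKO : Prop :=
  ∀ m a b : ℕ, 1 ≤ m → m < a → a < b → b ≤ a + m + 1 → ∀ α β : ℝ, (α ≠ 0 ∨ β ≠ 0) →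
    ∀ z : ℂ, (α : ℂ) * restrictedCycleStirling a m z + (β : ℂ) * restrictedCycleStirling b m z = 0 →
      z.im = 0

/-- The Poisson–Dirichlet scaling limit linking the avatar to the model cells of the crux:
`n · c_j(n, m) / n! → I_j(u)` as `m → ∞`, `n = ⌊u m⌋`… stated against the arithmetic cells directly
(both sides converge to the Buchstab–Dickman densities `I_j(u)`; Billingsley / Arratia–Barbour–Tavaré
for permutations, Alladi 1982 for rough integers): the normalised coefficient vectors become
proportional. -/
def RestrictedCycleScaling : Prop :=
  ∀ u : ℕ, 2 ≤ u → ∀ ε : ℝ, 0 < ε → ∃ m₀ : ℕ, ∀ m : ℕ, m₀ ≤ m → ∃ x₀ : ℕ, ∀ x : ℕ, x₀ ≤ x →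
    ∀ j ∈ Finset.Icc 1 u,
      |((((Finset.univ : Finset (Equiv.Perm (Fin (u * m)))).filter
          (fun σ => (∀ l ∈ σ.cycleType, m < l) ∧ Multiset.card σ.cycleType = j)).card : ℝ) *
          (u * m : ℕ) / Nat.factorial (u * m)) * (roughCell u x 1 : ℝ) - (roughCell u x j : ℝ)|
        ≤ ε * (roughCell u x 1 : ℝ)

end Summit.Parity.GeneralizedHardyLittlewood.Cruxes.FibreHyperbolicity.Ideator2
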